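import Summits.BirchSwinnertonDyer.BirchSwinnertonDyer.Theorems.ManinLocalTwoThreeWashingPrimePow
import Summits.BirchSwinnertonDyer.BirchSwinnertonDyer.Theorems.ManinLocalTwoThreeMultiHubPrimePow
import Literature.NumberTheory.EllipticCurves.PeriodLatticeGamma1QuotientProofs

/-!
# E-es-111♯ IS A THEOREM: THE Γ₁-NORMALISED TOWER UNIT-TWIST LAW `GammaOneTowerUnitTwist p` holds for every prime `p`, WITHOUT the
# plus-index hypothesis (P-es-7, MEMO-es §38.5 / §38.5-bis; cell bsd-f2-manin, seat `bsd-line-manin23-p2` gen 12)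

Summit `BirchSwinnertonDyer`, route `ManinLocalTwoThree`, crux C2 `ManinOddAtFour` (stmt-BirchSwinnertonDyer-22967), skeleton v14 stub 6
(the blind-locus cell).  The tree's tower theorem `towerUnitTwist_holds : p.Prime → KatoCurve.TowerUnitTwist p` (…RigidityImpliesTower) reads:
for the newform `f` of `W` with `PlusIndexPrimeTo p f`, arbitrarily high in every admissible `q`-power conductor tower there is a primitive
even `χ` whose Euler-corrected twisted symbol sum is a `p`-adic UNIT against `Ω⁺_f` (the Γ₀-plus period).  The es lens (MEMO-es §38)
observed that the hypothesis is consumed only in the last line and proposed the Γ₁-renormalised law E-es-111♯ `GammaOneTowerUnitTwist p`: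
the same conclusion against the Γ₁-plus period `2·re y`, `y` a generator of `re Λ₁(f)`, with NO hypothesis — non-empty exactly on the blind
locus (POLAR-N5000: the 21 classes ≤ 5000 with a Γ₁-unit and no Γ₀-unit).  THIS FILE PROVES IT, by re-running the tower proof at the modulus
`p^(v+1)`, `p^v ∥ k′ := 2 re y / Ω⁺_f` (the plus index):

* `exists_primitive_even_unitTwist_primePow` — the tower theorem AT MODULUS `p^(v+1)` under `PlusIndexPrimeTo (p^(v+1)) f`: some primitive
  even `χ` of conductor `qⁿ`, `n ≥ n₁`, has Euler-corrected value `r·Ω⁺_f` with `s·r/p^(v+1) ∉ ℤ̄` for all `p ∤ s` (proof = ll. 93–256 of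
  …RigidityImpliesTower with (TV) from `plus_primePow_dvd_of_forall_not_unitTwist` (H1, …WashingPrimePow), E-an-142 from
  `MultiHubPrimePow.tvPattern_levelLinear_primePow` (H2), E-an-143 `levelLinear_telescope` and `false_of_gamma1_plusPart_dvd` instantiated at
  the modulus `p^(v+1)` (H3, H4 — modulus-generic in the tree));
* `exists_re_generator_periodLatticeGamma1` (es g24 Sketch §4, hypothesis-free here via `totient_mul_mem_periodLatticeGamma1`) — a Γ₁-period
  `y` with `re y ≠ 0` generating `re Λ₁(f)`; `plusIndexPrimeTo_primePow_of_generator` — `PlusIndexPrimeTo (p^(v+1)) f` for `p^v ∥ k′`;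
* **`exists_primitive_even_gammaOneUnitTwistAt`** — E-es-111♯ BY VALUE: for EVERY rational newform `f` of `W` (no plus-index hypothesis), every
  odd prime `q ≠ p`, `q ∤ N`, `p ∤ (q−1)/2`, every `n₁`: some primitive even `χ` of conductor `qⁿ`, `n ≥ n₁`, satisfies es's
  `GammaOneUnitTwistAt p W f χ` clause verbatim (`∃ r y, y ∈ Λ₁(f), re y ≠ 0, re y generates re Λ₁(f), e_χ·S_χ = r·(2 re y),
  ∀ s, p ∤ s → s·r/p ∉ ℤ̄`).  The by-name corollary `gammaOneTowerUnitTwist_holds : GammaOneTowerUnitTwist p` is one line once the typer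
  files es's definition (T-es-37).

HONEST FRAMING (es §38.4): this is the f-intrinsic HALF of stub 6; the Néron half (Kato integrality w.r.t. `T₂E₁` on blind classes, E-es-110)
is untouched; C2 `ManinOddAtFour`, Manin's conjecture and BSD are NOT proved by this file.  No definitions, no named facts, no sorry.
-/

set_option linter.dupNamespace false
set_option autoImplicit false

noncomputable section

open scoped Classical MatrixGroups ModularForm ComplexConjugate

open CongruenceSubgroup Complex Literature.NumberTheory.EllipticCurves
  Literature.NumberTheory.EllipticCurves.ModularForms
  Summit.BirchSwinnertonDyer.Rank1Residual.ManinAdditive.Gamma1Lattice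
  Summit.BirchSwinnertonDyer.Rank1Residual.ManinAdditive.KatoCurve
  Summit.BirchSwinnertonDyer.Rank1Residual.ManinAdditive.TowerExtension

namespace Summit.BirchSwinnertonDyer.BirchSwinnertonDyer.Theorems.ManinLocalTwoThree

/-! ### §1 The tower theorem at the modulus `p^(v+1)` -/

/-- **THE TOWER UNIT-TWIST THEOREM AT THE MODULUS `p^(v+1)`**: for the newform `f` of `W` with `PlusIndexPrimeTo (p^(v+1)) f`, an odd
prime `q ≠ p`, `q ∤ N`, `p ∤ (q−1)/2`, and every `n₁`, some PRIMITIVE EVEN `χ` of conductor `qⁿ`, `n ≥ n₁`, has Euler-corrected twisted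
symbol sum `r·Ω⁺_f` with `s·r/p^(v+1) ∉ ℤ̄` for every `p ∤ s` (`exists_primitive_even_unitTwistAt` is `v = 0`; same proof at the
modulus `p^(v+1)`). -/
theorem exists_primitive_even_unitTwist_primePow {p : ℕ} (hp : p.Prime) (v : ℕ) (W : WeierstrassCurve ℚ) [W.IsElliptic]
    {N : ℕ} [NeZero N] (f : CuspForm (Gamma0 N) 2) (hWf : IsNewformOf W f) (hpi : PlusIndexPrimeTo (p ^ (v + 1)) f)
    (q : ℕ) [Fact q.Prime] (hq3 : 3 ≤ q) (hqp : q ≠ p) (hqN : ¬ q ∣ N) (hpdiv : ¬ p ∣ (q - 1) / 2) (n₁ : ℕ) :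
    ∃ n : ℕ, n₁ ≤ n ∧ ∃ χ : DirichletCharacter ℂ (q ^ n), χ.IsPrimitive ∧ χ.Even ∧
      ∃ r : ℂ,
        (∏ ℓ ∈ N.primeFactors with ¬ ℓ ^ 2 ∣ N,
            (((ℓ : ℂ) - (W.LFunction ℓ : ℂ) * χ (ℓ : ZMod (q ^ n))) *
              ((ℓ : ℂ) - (W.LFunction ℓ : ℂ) * (χ (ℓ : ZMod (q ^ n)))⁻¹))) *
            twistedSymbolSum f χ = r * (plusPeriod f : ℂ) ∧
        ∀ s : ℕ, ¬ p ∣ s → ¬ IsIntegral ℤ ((s : ℂ) * r / (p : ℂ) ^ (v + 1)) := by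
  have hq : q.Prime := Fact.out
  haveI : NeZero (p ^ (v + 1)) := ⟨pow_ne_zero _ hp.ne_zero⟩
  have hq2 : q ≠ 2 := by omega
  have hf : IsNewform0 f := hWf.1
  have hQ : coeffField f = ⊥ := hWf.coeffField_eq_bot
  have hNpos : 0 < N := Nat.pos_of_ne_zero (NeZero.ne N)
  have hqNcop : q.Coprime N := (Nat.Prime.coprime_iff_not_dvd hq).mpr hqN
  have hqpN : ¬ q ∣ p * N := by
    intro h
    rcases (Nat.Prime.dvd_mul hq).mp h with h1 | h1
    · exact hqp ((Nat.prime_dvd_prime_iff_eq hq hp).mp h1)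
    · exact hqN h1
  by_contra hcon
  have hno : ∀ n : ℕ, n₁ ≤ n → ∀ χ : DirichletCharacter ℂ (q ^ n), χ.IsPrimitive → χ.Even →
      ¬ ∃ r : ℂ,
        (∏ ℓ ∈ N.primeFactors with ¬ ℓ ^ 2 ∣ N,
            (((ℓ : ℂ) - (W.LFunction ℓ : ℂ) * χ (ℓ : ZMod (q ^ n))) *
              ((ℓ : ℂ) - (W.LFunction ℓ : ℂ) * (χ (ℓ : ZMod (q ^ n)))⁻¹))) *
            twistedSymbolSum f χ = r * (plusPeriod f : ℂ) ∧
        ∀ s : ℕ, ¬ p ∣ s → ¬ IsIntegral ℤ ((s : ℂ) * r / (p : ℂ) ^ (v + 1)) :=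
    fun n hn χ h1 h2 h3 ↦ hcon ⟨n, hn, χ, h1, h2, h3⟩
  -- the Wieferich level of the multiplicative primes and the starting level `s + 1`
  set nW : ℕ := (N.primeFactors.filter (fun ℓ ↦ ¬ ℓ ^ 2 ∣ N)).sup
    (fun ℓ ↦ padicValNat q ((ℓ ^ (p - 1)) ^ (q - 1) - 1)) + 1 with hnW
  set s : ℕ := max n₁ (max 2 nW) - 1 with hs
  have hs1 : s + 1 = max n₁ (max 2 nW) := by omega
  -- the plus functionals
  choose F hF using exists_int_plusPart (N := N) hf hQ
  choose Fc hFc using exists_int_plusPart_cuspSymbol (N := N) hf hQ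
  set g : ℕ → ℤ → ZMod (p ^ (v + 1)) := fun n r ↦ ((F ((r : ℚ) / (q : ℚ) ^ n) : ℤ) : ZMod (p ^ (v + 1))) with hg
  set c : SL(2, ℤ) → ZMod (p ^ (v + 1)) := fun γ ↦ ((Fc γ : ℤ) : ZMod (p ^ (v + 1))) with hc
  set a : ZMod (p ^ (v + 1)) := ((W.LFunction q : ℤ) : ZMod (p ^ (v + 1))) with ha
  set κ : ZMod (p ^ (v + 1)) := ∑ t ∈ Finset.range q, g 1 (t : ℤ) with hκ
  -- (P0)
  have hP0 : ∀ r : ℤ, g 0 r = 0 := by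
    intro r
    simp only [hg, pow_zero, div_one]
    rw [plusFun_intCast hf hQ F hF r, Int.cast_zero]
  -- (P1)
  have hP1 : ∀ (n : ℕ) (r : ℤ), g n (r + (q : ℤ) ^ n) = g n r := by
    intro n r
    simp only [hg]
    have hqn : ((q : ℚ) ^ n) ≠ 0 := pow_ne_zero _ (by exact_mod_cast hq.ne_zero)
    have e : (((r + (q : ℤ) ^ n : ℤ)) : ℚ) / (q : ℚ) ^ n = (r : ℚ) / (q : ℚ) ^ n + ((1 : ℤ) : ℚ) := by
      push_cast; field_simp
    rw [e, plusFun_add_intCast hf hQ F hF _ (coprime_den_intCast_div_primePow hq hqN r n) 1]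
  -- (P2)
  have hP2 : ∀ (n : ℕ) (r : ℤ), g (n + 1) ((q : ℤ) * r) = g n r := by
    intro n r
    simp only [hg]
    have hq0 : (q : ℚ) ≠ 0 := by exact_mod_cast hq.ne_zero
    have e : ((((q : ℤ) * r : ℤ)) : ℚ) / (q : ℚ) ^ (n + 1) = (r : ℚ) / (q : ℚ) ^ n := by
      push_cast; field_simp; ring
    rw [e]
  -- (EV)
  have hEV : ∀ (n : ℕ) (r : ℤ), g n (-r) = g n r := by
    intro n r
    simp only [hg]
    have e : (((-r : ℤ)) : ℚ) / (q : ℚ) ^ n = -((r : ℚ) / (q : ℚ) ^ n) := by push_cast; ring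
    rw [e, plusFun_neg hf hQ F hF _ (coprime_den_intCast_div_primePow hq hqN r n)]
  -- (TV) from level `s + 1` on
  have hTV : ∀ (n : ℕ) (r : ℤ), s + 1 ≤ n → IsCoprime r (q : ℤ) → g n (r + (q : ℤ) ^ (n - 1)) = g n r := by
    intro n r hn hr
    simp only [hg]
    have hn2 : 2 ≤ n := by omega
    have hnn₁ : n₁ ≤ n := by omega
    have hnWn : nW ≤ n := by omega
    have hb : ¬ (q : ℤ) ∣ r := by
      intro h
      have := Int.isCoprime_iff_gcd_eq_one.mp hr
      have h1 : (q : ℤ) ∣ 1 := by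
        have := hr; exact (IsCoprime.dvd_of_dvd_mul_left (this.symm) (dvd_mul_of_dvd_left h 1)) |> fun x => by simpa using x
      exact hq.one_lt.ne' (by exact_mod_cast Int.eq_one_of_dvd_one (by positivity) h1)
    have hnW' : ∀ ℓ ∈ N.primeFactors, ¬ ℓ ^ 2 ∣ N → padicValNat q ((ℓ ^ (p - 1)) ^ (q - 1) - 1) < n := by
      intro ℓ hℓ hℓ2
      have hℓS : ℓ ∈ N.primeFactors.filter (fun ℓ ↦ ¬ ℓ ^ 2 ∣ N) := Finset.mem_filter.mpr ⟨hℓ, hℓ2⟩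
      have h1 : padicValNat q ((ℓ ^ (p - 1)) ^ (q - 1) - 1) ≤
          (N.primeFactors.filter (fun ℓ ↦ ¬ ℓ ^ 2 ∣ N)).sup (fun ℓ ↦ padicValNat q ((ℓ ^ (p - 1)) ^ (q - 1) - 1)) :=
        Finset.le_sup (f := fun ℓ ↦ padicValNat q ((ℓ ^ (p - 1)) ^ (q - 1) - 1)) hℓS
      omega
    set x₁ : ℚ := (((r + 1 * (q : ℤ) ^ (n - 1) : ℤ)) : ℚ) / (q : ℚ) ^ n with hx₁
    set x₂ : ℚ := (r : ℚ) / (q : ℚ) ^ n with hx₂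
    have hx₁d : Nat.Coprime x₁.den N := coprime_den_intCast_div_primePow hq hqN _ n
    have hx₂d : Nat.Coprime x₂.den N := coprime_den_intCast_div_primePow hq hqN r n
    have hj : (modularSymbol f x₁ - modularSymbol f x₂) + conj (modularSymbol f x₁ - modularSymbol f x₂) =
        ((F x₁ - F x₂ : ℤ) : ℂ) * (plusPeriod f : ℂ) := by
      have e : modularSymbol f x₁ - modularSymbol f x₂ =
          (modularSymbol f x₁ - modularSymbol f 0) - (modularSymbol f x₂ - modularSymbol f 0) := by ring
      rw [e, map_sub, Int.cast_sub, sub_mul, ← hF x₁ hx₁d, ← hF x₂ hx₂d]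
      ring
    have hdvd := plus_primePow_dvd_of_forall_not_unitTwist hWf hp (v + 1) hq2 hqp hqN hpdiv hn2 hnW' (hno n hnn₁) hb hj
    have e1 : (((r + (q : ℤ) ^ (n - 1) : ℤ)) : ℚ) / (q : ℚ) ^ n = x₁ := by rw [hx₁, one_mul]
    rw [e1]
    exact ((ZMod.intCast_eq_intCast_iff_dvd_sub _ _ _).mpr (by push_cast; simpa using hdvd)).symm
  -- (HK)
  have hHK : ∀ (m : ℕ) (r : ℤ),
      ∑ t ∈ Finset.range q, g (m + 1) (r + (t : ℤ) * (q : ℤ) ^ m) = a * g m r - g (m - 1) r + κ := by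
    intro m r
    have h := plusFun_hecke hWf hq hqN F hF m r
    -- identify `F(q r / q^m)` with the value behind `g (m - 1) r`
    have hlow : F ((((q : ℤ) * r : ℤ) : ℚ) / (q : ℚ) ^ m) = F ((r : ℚ) / (q : ℚ) ^ (m - 1)) := by
      rcases m with _ | k
      · simp only [Nat.zero_sub, pow_zero, div_one]
        rw [plusFun_intCast hf hQ F hF, plusFun_intCast hf hQ F hF]
      · simp only [Nat.add_sub_cancel]
        congr 1
        have hq0 : (q : ℚ) ≠ 0 := by exact_mod_cast hq.ne_zero
        push_cast; field_simp; ring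
    rw [hlow] at h
    simp only [hg, hκ, ha]
    rw [← Int.cast_sum, h]
    push_cast
    ring
  -- (inv)
  have hINV : ∀ γ : SL(2, ℤ), (N : ℤ) ∣ (γ : Matrix (Fin 2) (Fin 2) ℤ) 1 0 →
      ∀ (r : ℤ) (i j : ℕ) (ε : ℤˣ),
        (γ : Matrix (Fin 2) (Fin 2) ℤ) 1 0 * r + (γ : Matrix (Fin 2) (Fin 2) ℤ) 1 1 * (q : ℤ) ^ i =
          (ε : ℤ) * (q : ℤ) ^ j →
        g j ((ε : ℤ) * ((γ : Matrix (Fin 2) (Fin 2) ℤ) 0 0 * r + (γ : Matrix (Fin 2) (Fin 2) ℤ) 0 1 * (q : ℤ) ^ i)) -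
          g i r = c γ := by
    intro γ hγN r i j ε hrow
    simp only [hg, hc]
    have hγ : γ ∈ Gamma0 N := by
      rw [Gamma0_mem]
      exact (ZMod.intCast_zmod_eq_zero_iff_dvd _ N).mpr hγN
    have hD : ((q : ℤ) ^ i) ≠ 0 := pow_ne_zero _ (by exact_mod_cast hq.ne_zero)
    have hDN : IsCoprime ((q : ℤ) ^ i) (N : ℤ) :=
      IsCoprime.pow_left (Nat.isCoprime_iff_coprime.mpr hqNcop)
    have hden : γ 1 0 * r + γ 1 1 * (q : ℤ) ^ i ≠ 0 := by
      rw [hrow]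
      exact mul_ne_zero (Units.ne_zero ε) (pow_ne_zero _ (by exact_mod_cast hq.ne_zero))
    have h6 := plusFun_gamma0 hf hQ F hF Fc hFc γ hγ r ((q : ℤ) ^ i) hD hDN hden
    have hqj : ((q : ℚ) ^ j) ≠ 0 := pow_ne_zero _ (by exact_mod_cast hq.ne_zero)
    have e1 : (((γ 0 0 * r + γ 0 1 * (q : ℤ) ^ i : ℤ)) : ℚ) / ((γ 1 0 * r + γ 1 1 * (q : ℤ) ^ i : ℤ) : ℚ) =
        ((((ε : ℤ) * (γ 0 0 * r + γ 0 1 * (q : ℤ) ^ i) : ℤ)) : ℚ) / (q : ℚ) ^ j := by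
      rw [hrow]
      rcases Int.units_eq_one_or ε with hε | hε
      · rw [hε]; push_cast; ring
      · rw [hε]; push_cast
        rw [neg_one_mul, neg_one_mul, div_neg, neg_div]
    have e2 : (((q : ℤ) ^ i : ℤ) : ℚ) = (q : ℚ) ^ i := by push_cast; ring
    rw [e1, e2] at h6
    rw [h6]
    push_cast
    ring
  -- E-an-142
  obtain ⟨κ', hκ'⟩ := MultiHubPrimePow.tvPattern_levelLinear_primePow hp hq hq3 hqpN hpdiv hNpos v a κ s g c hP0 hP1 hP2 hEV hTV rfl
    hHK hINV
  -- E-an-143: `c` vanishes on `Γ₁(N)`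
  have hc0 : ∀ γ : SL(2, ℤ), γ ∈ Gamma0 N → (N : ℤ) ∣ γ 1 1 - 1 → (γ 1 1 : ℤ) ≠ 0 → ((p ^ (v + 1) : ℕ) : ℤ) ∣ Fc γ := by
    intro γ hγ hγ1 hγne
    have hγN : (N : ℤ) ∣ γ 1 0 := by
      have := Gamma0_mem.mp hγ
      exact (ZMod.intCast_zmod_eq_zero_iff_dvd _ N).mp this
    have h := levelLinear_telescope (p := p ^ (v + 1)) hq hqNcop (fun x ↦ ((F x : ℤ) : ZMod (p ^ (v + 1)))) c κ'
      (fun γ' hγ' B D hD hDN hden ↦ by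
        have hγ'0 : γ' ∈ Gamma0 N := by
          rw [Gamma0_mem]
          exact (ZMod.intCast_zmod_eq_zero_iff_dvd _ N).mpr hγ'
        have := plusFun_gamma0 hf hQ F hF Fc hFc γ' hγ'0 B D hD hDN hden
        simp only [hc, this]
        push_cast
        ring)
      (fun x hx ↦ by simp only [plusFun_neg hf hQ F hF x hx])
      (fun u ↦ by simp only [plusFun_intCast hf hQ F hF u, Int.cast_zero])
      (fun m u hu ↦ hκ' m u hu) γ hγN hγ1 hγne
    simp only [hc] at h
    exact (ZMod.intCast_zmod_eq_zero_iff_dvd _ _).mp h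
  exact false_of_gamma1_plusPart_dvd hf hQ hpi Fc hFc hc0

/-! ### §2 The Γ₁-plus generator and the plus index -/

/-- **A generator of `re Λ₁(f)` attained by a Γ₁-period** (es g24, Sketch §4 `exists_re_generator_periodLatticeGamma1`, here
hypothesis-free): `re Λ₁(f)` sits inside `re Λ_f = ℤ·Ω⁺_f/2`, is isolated from `0`, hence cyclic (`AddSubgroup.cyclic_of_isolated_zero`),
and is non-zero because `φ(N)·Λ_f ⊆ Λ₁(f)` (`totient_mul_mem_periodLatticeGamma1`). -/
theorem exists_re_generator_periodLatticeGamma1 {N : ℕ} [NeZero N] (f : CuspForm (Gamma0 N) 2)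
    (hf : IsNewform0 f) (hQ : coeffField f = ⊥) :
    ∃ y ∈ periodLatticeGamma1 f, y.re ≠ 0 ∧ ∀ x ∈ periodLatticeGamma1 f, ∃ j : ℤ, x.re = j * y.re := by
  have hpos : 0 < plusPeriod f := IsNewform0.plusPeriod_pos_holds hf hQ
  have hre : realPeriods f = AddSubgroup.zmultiples (plusPeriod f / 2) :=
    realPeriods_eq_zmultiples_of_plusPeriod_pos f hpos
  -- some Γ₁-period has non-zero real part: `φ(N)·x` for `x ∈ Λ_f` with `re x = Ω⁺/2`
  have hne : ∃ y ∈ periodLatticeGamma1 f, y.re ≠ 0 := by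
    have hmem : plusPeriod f / 2 ∈ realPeriods f := by rw [hre]; exact AddSubgroup.mem_zmultiples _
    rw [realPeriods, AddSubgroup.mem_map] at hmem
    obtain ⟨x, hx, hxre⟩ := hmem
    have hxre' : x.re = plusPeriod f / 2 := by simpa using hxre
    refine ⟨(Nat.totient N : ℂ) * x, totient_mul_mem_periodLatticeGamma1 f hx, ?_⟩
    have hφ : (0 : ℝ) < (Nat.totient N : ℝ) := by exact_mod_cast Nat.totient_pos.mpr (Nat.pos_of_ne_zero (NeZero.ne N))
    simp only [Complex.mul_re, Complex.natCast_re, Complex.natCast_im, zero_mul, sub_zero, hxre']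
    positivity
  let H : AddSubgroup ℝ := (periodLatticeGamma1 f).map Complex.reLm.toAddMonoidHom
  have hHle : H ≤ realPeriods f := AddSubgroup.map_mono (periodLatticeGamma1_le_periodLattice f)
  -- `H` is isolated from `0`: its elements are integer multiples of `Ω⁺/2`
  have hdisj : Disjoint (H : Set ℝ) (Set.Ioo 0 (plusPeriod f / 2)) := by
    rw [Set.disjoint_left]
    intro t ht hIoo
    have ht' : t ∈ realPeriods f := hHle ht
    rw [hre, AddSubgroup.mem_zmultiples_iff] at ht'
    obtain ⟨k, hk⟩ := ht'
    rw [zsmul_eq_mul] at hk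
    rcases hIoo with ⟨h0, h1⟩
    have hk0 : (0 : ℝ) < k := by
      by_contra hle; push Not at hle
      have : (k : ℝ) * (plusPeriod f / 2) ≤ 0 := mul_nonpos_of_nonpos_of_nonneg hle (by linarith)
      linarith
    have hk1 : (k : ℝ) < 1 := by
      by_contra hge; push Not at hge
      have : plusPeriod f / 2 ≤ (k : ℝ) * (plusPeriod f / 2) := by nlinarith
      linarith
    have hk0' : (0 : ℤ) < k := by exact_mod_cast hk0
    have hk1' : k < 1 := by exact_mod_cast hk1
    omega
  obtain ⟨b, hb⟩ := AddSubgroup.cyclic_of_isolated_zero (H := H) (by linarith : (0 : ℝ) < plusPeriod f / 2) hdisj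
  have hbH : b ∈ H := by rw [hb]; exact AddSubgroup.subset_closure (Set.mem_singleton b)
  obtain ⟨y, hy, hyb⟩ := AddSubgroup.mem_map.mp hbH
  have hyb' : y.re = b := by simpa using hyb
  refine ⟨y, hy, ?_, ?_⟩
  · obtain ⟨y₀, hy₀, hy₀re⟩ := hne
    have hy₀H : y₀.re ∈ H := AddSubgroup.mem_map.mpr ⟨y₀, hy₀, by simp⟩
    rw [hb, AddSubgroup.mem_closure_singleton] at hy₀H
    obtain ⟨n, hn⟩ := hy₀H
    intro hb0
    apply hy₀re
    have hb0' : b = 0 := by rw [← hyb']; exact hb0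
    rw [← hn, hb0', smul_zero]
  · intro x hx
    have hxH : x.re ∈ H := AddSubgroup.mem_map.mpr ⟨x, hx, by simp⟩
    rw [hb, AddSubgroup.mem_closure_singleton] at hxH
    obtain ⟨n, hn⟩ := hxH
    exact ⟨n, by rw [← hn, hyb', zsmul_eq_mul]⟩

/-- **`PlusIndexPrimeTo (p^(v+1)) f` from a Γ₁-period `y` with plus part `k′·Ω⁺_f`, `p^(v+1) ∤ k′`**: the plus part `j·Ω⁺_f` of any
`x ∈ Λ_f` satisfies `|k′|·(x + x̄) = y′ + ȳ′` with `y′ = (sign k′ · j)·y ∈ Λ₁(f)`. -/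
theorem plusIndexPrimeTo_of_gamma1_plusPart {N : ℕ} [NeZero N] {f : CuspForm (Gamma0 N) 2}
    (hf : IsNewform0 f) (hQ : coeffField f = ⊥) {M : ℕ} {y : ℂ} (hy : y ∈ periodLatticeGamma1 f) {k' : ℤ}
    (hk' : y + conj y = (k' : ℂ) * (plusPeriod f : ℂ)) (hMk : ¬ (M : ℤ) ∣ k') : PlusIndexPrimeTo M f := by
  intro x hx
  obtain ⟨j, hj⟩ := exists_int_add_conj_eq_mul_plusPeriod hf hQ hx
  refine ⟨(k'.sign * j) • y, AddSubgroup.zsmul_mem _ hy _, k'.natAbs, fun h ↦ hMk (Int.natCast_dvd.mpr h), ?_⟩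
  rw [hj, zsmul_eq_mul, map_mul, map_intCast, ← mul_add, hk']
  have e : ((k'.natAbs : ℕ) : ℂ) = ((k'.sign * k' : ℤ) : ℂ) := by
    rw [Int.sign_mul_self_eq_natAbs, Int.cast_natCast]
  rw [e]
  push_cast
  ring

/-! ### §3 E-es-111♯ by value -/

/-- **E-es-111♯ `GammaOneTowerUnitTwist p` BY VALUE — THE Γ₁-NORMALISED TOWER UNIT-TWIST LAW IS A THEOREM, NO PLUS-INDEX HYPOTHESIS.**
For a prime `p`, the rational newform `f` of `W` on `Γ₀(N)`, an odd prime `q ≠ p` with `q ∤ N` and `p ∤ (q−1)/2`, and every `n₁`: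
some PRIMITIVE EVEN `χ` of conductor `qⁿ`, `n ≥ n₁`, satisfies es's `GammaOneUnitTwistAt p W f χ` (its body verbatim): there are
`r : ℂ` and a Γ₁-period `y ∈ Λ₁(f)` with `re y ≠ 0` generating `re Λ₁(f)` such that the Euler-corrected twisted symbol sum equals
`r·(2 re y)` and `s·r/p ∉ ℤ̄` for every `p ∤ s`.  Proof: `y` from `exists_re_generator_periodLatticeGamma1`, `2 re y = k′·Ω⁺_f`,
`p^v ∥ k′`; `PlusIndexPrimeTo (p^(v+1)) f` (`plusIndexPrimeTo_of_gamma1_plusPart`); the modulus-`p^(v+1)` tower theorem gives `r₀` with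
`s·r₀/p^(v+1) ∉ ℤ̄`; `r := r₀/k′`, and `s·r/p ∈ ℤ̄` would give `(k′/p^v)·s·r/p = s·r₀/p^(v+1) ∈ ℤ̄`. -/
theorem exists_primitive_even_gammaOneUnitTwistAt {p : ℕ} (hp : p.Prime) (W : WeierstrassCurve ℚ) [W.IsElliptic]
    {N : ℕ} [NeZero N] (f : CuspForm (Gamma0 N) 2) (hWf : IsNewformOf W f)
    (q : ℕ) [Fact q.Prime] (hq2 : q ≠ 2) (hqp : q ≠ p) (hqN : ¬ q ∣ N) (hpdiv : ¬ p ∣ (q - 1) / 2) (n₁ : ℕ) :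
    ∃ n : ℕ, n₁ ≤ n ∧ ∃ χ : DirichletCharacter ℂ (q ^ n), χ.IsPrimitive ∧ χ.Even ∧
      ∃ (r : ℂ) (y : ℂ), y ∈ periodLatticeGamma1 f ∧ y.re ≠ 0 ∧
        (∀ x ∈ periodLatticeGamma1 f, ∃ j : ℤ, x.re = j * y.re) ∧
        (∏ ℓ ∈ N.primeFactors with ¬ ℓ ^ 2 ∣ N,
            (((ℓ : ℂ) - (W.LFunction ℓ : ℂ) * χ (ℓ : ZMod (q ^ n))) *
              ((ℓ : ℂ) - (W.LFunction ℓ : ℂ) * (χ (ℓ : ZMod (q ^ n)))⁻¹))) *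
            twistedSymbolSum f χ = r * ((2 * y.re : ℝ) : ℂ) ∧
        ∀ s : ℕ, ¬ p ∣ s → ¬ IsIntegral ℤ ((s : ℂ) * r / p) := by
  have hq : q.Prime := Fact.out
  haveI : Fact p.Prime := ⟨hp⟩
  have hq3 : 3 ≤ q := by
    rcases hq.eq_two_or_odd' with h | h
    · exact absurd h hq2
    · have := hq.two_le; rcases h with ⟨k, hk⟩; omega
  have hf : IsNewform0 f := hWf.1
  have hQ : coeffField f = ⊥ := hWf.coeffField_eq_bot
  obtain ⟨hpos, -⟩ := plusPeriod_pos_and_realPeriods_eq isZLattice_periodLattice_holds hf hQ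
  have hΩ : (plusPeriod f : ℂ) ≠ 0 := by exact_mod_cast hpos.ne'
  -- the Γ₁-plus generator and its index `k'`
  obtain ⟨y, hy, hyre, hygen⟩ := exists_re_generator_periodLatticeGamma1 f hf hQ
  obtain ⟨k', hk'⟩ := exists_int_add_conj_eq_mul_plusPeriod hf hQ (periodLatticeGamma1_le_periodLattice f hy)
  have h2re : ((2 * y.re : ℝ) : ℂ) = (k' : ℂ) * (plusPeriod f : ℂ) := by
    rw [← hk', Complex.add_conj]
  have hk'0 : k' ≠ 0 := by
    rintro rfl
    have h := congrArg Complex.re hk'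
    simp at h
    exact hyre (by linarith)
  -- `p^v ∥ k'`
  set v : ℕ := padicValInt p k' with hv
  obtain ⟨m, hm⟩ : (p : ℤ) ^ v ∣ k' := padicValInt_dvd k'
  have hnot : ¬ (p : ℤ) ^ (v + 1) ∣ k' := by
    rw [padicValInt_dvd_iff]
    push Not
    exact ⟨hk'0, by omega⟩
  have hpi : PlusIndexPrimeTo (p ^ (v + 1)) f :=
    plusIndexPrimeTo_of_gamma1_plusPart hf hQ hy hk' (by push_cast; exact hnot)
  -- the tower theorem at the modulus `p^(v+1)`
  obtain ⟨n, hn, χ, hprim, hev, r₀, hr₀, hunit⟩ :=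
    exists_primitive_even_unitTwist_primePow hp v W f hWf hpi q hq3 hqp hqN hpdiv n₁
  refine ⟨n, hn, χ, hprim, hev, r₀ / k', y, hy, hyre, hygen, ?_, ?_⟩
  · have hk'C : (k' : ℂ) ≠ 0 := by exact_mod_cast hk'0
    rw [hr₀, h2re]
    field_simp
  · intro s hs hI
    apply hunit s hs
    -- multiply `s·(r₀/k')/p ∈ ℤ̄` by the integer `m = k'/p^v`
    have hp0 : (p : ℂ) ≠ 0 := by exact_mod_cast hp.ne_zero
    have hk'C : (k' : ℂ) ≠ 0 := by exact_mod_cast hk'0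
    have hm0 : (m : ℂ) ≠ 0 := by
      rintro hm0
      have : m = 0 := by exact_mod_cast hm0
      rw [this, mul_zero] at hm
      exact hk'0 hm
    have e : (s : ℂ) * r₀ / (p : ℂ) ^ (v + 1) = (m : ℂ) * ((s : ℂ) * (r₀ / k') / p) := by
      have hk'e : (k' : ℂ) = (p : ℂ) ^ v * m := by exact_mod_cast hm
      rw [hk'e]
      field_simp
      ring
    rw [e]
    exact (isIntegral_algebraMap (R := ℤ) (A := ℂ) (x := m)).mul hI

end Summit.BirchSwinnertonDyer.BirchSwinnertonDyer.Theorems.ManinLocalTwoThree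

end
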